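import Summits.BirchSwinnertonDyer.BirchSwinnertonDyer.Theorems.RamifiedHeegnerPairLeafCartanKernelCore
import Summits.BirchSwinnertonDyer.BirchSwinnertonDyer.Theorems.RamifiedHeegnerPairLeafHabitatSocket
import Summits.BirchSwinnertonDyer.BirchSwinnertonDyer.Theorems.ClassRecordThreeEulerHalvesAtThreeResidualUpperBoundCartanPlaceTwistLaw
import Summits.BirchSwinnertonDyer.Rank1Residual.X11b.BDPRouteTamagawaSupport
import HarnessLib

/-!
# Route `RamifiedHeegnerPair`, crux U₁ `LeafRankOneUpperAtThree` (stmt-BirchSwinnertonDyer-26022), line `nscartan` —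
# KERNEL_leaf, part 2: ROAD(HabNs) from the leaf Cartan SAVED display, the Cartan twist supply WITH `2` SPLIT, (F5′), print and L₀

HONEST FRAMING. Theorems only; helper file (`--supports stmt-BirchSwinnertonDyer-26022 --as helper`); no definition, no named fact, no `sorry`;
CONDITIONAL on every displayed input; item 26022 is NOT closed; BSD is proved for no curve. Lead prover bsd-line-rhp-p2 g53, 2026-08-30.

WHAT. `leafCartanRoad_of_display_of_supply_of_lowerRankZero` = the registered bookkeeping stub `stub_leafCartanKernelAtThree` of line nscartan
(v16.2 bf1f577791656162) with its inputs displayed and ONE input CORRECTED: on a non-CM Gss2 leaf curve `W` of analytic rank one carrying a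
lattice-optimal datum (`3 ∤ c`) and satisfying the habitat `HabNs W` (spelled inline: `ρ̄₃` onto; a Cartan set `C` of primes `q ≠ 3`, `q² ∥ N`,
`3 ∣ c_q`; at most one further prime `q₁ ≠ 3` with `3 ∣ c`), `Typed.MissingUpperBoundAt W 3` follows from
* the leaf Cartan SAVED display (`hDisp`, = `Nscartan.LeafCartanSavedDisplayAtThree` inline; DERIVED from NUM_leaf by p767141),
* the Cartan twist supply **with `2` split when `2 ∤ N`** (`hFH`: Friedberg–Hoffstein Thm. B with the places of `C` inert, every other prime of
  `N` split AND `2` split if `2 ∤ N` — the registered stub asked `friedbergHoffstein_exists_twist_ne_zero_inertAt_sq`, which has NO clause at `2`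
  when `2 ∤ N_W` and `2 ∉ C`, so `d_K` could be even; the leaf machine (part 1, and the leaf-stability lemma `leaf_twist_of_split_three`) needs
  `d_K` ODD — the lineage met the same point on line splitkolyvagin and stated `friedbergHoffstein_exists_twist_ne_zero_inertAt_splitAt`
  (…ShimuraInertOddSupply, g10); `hFH` is its Cartan twin, a special case of the same theorem of Friedberg–Hoffstein, displayed here as a
  hypothesis for the pen ∕ a typer to file as the Literature fact `friedbergHoffstein_exists_twist_ne_zero_inertAt_sq_splitTwo`),
* (F5′) the PROVED un-doubling law at a Cartan place (`CartanPlaceTwistLaw.cartanPlaceTwistLawAtThree`, p670426, used by name),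
* the print (GZK, entireness, modularity, JL, Pasten component orders) and L₀ (item 26023) at the rank-zero LEAF partner.
PROOF = the sibling kernel `CartanKernel.missingUpperBoundAt_three_of_classX11b_of_surj_of_monoCarrierOffCartanSet` (p662140, configuration (M),
`S = ∅`) transposed: the exempted bad place `e ∉ C` off which nothing carries is `q₁` if `q₁` is bad, else `3` itself (additive, `3 ∉ C`); the
SHAPE and très-ramifié clauses off `e` and `C` are vacuous by the habitat (`c_ℓ = ord_ℓ Δ_min` at split multiplicative `ℓ`); (DEG) is the
pairing disjunct at `R = S = ∅`; the field comes from `hFH` at `(S, C) := (∅, C)`, `B := 4` (so `d_K < −4`), with `d_K` odd because `2` is a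
Cartan place, a split bad prime, or split by the clause; the display is instantiated at `(K, ∅, C)`; the partner's lower half is L₀ at the
minimal twist, a rank-zero leaf curve (`leaf_twist_of_split_three`, `3` split since `3 ∉ C` is bad); then part 1
(`LeafCartanKernel.leafRankOneUpper_three_of_shimuraInertDatum_at_saving_of_budgetSet`, p767743).
-- adapted from Summits/BirchSwinnertonDyer/BirchSwinnertonDyer/Theorems/ClassRecordThreeEulerHalvesAtThreeCartanKernelOfInputs.lean (configuration (M), S = ∅)
References: [cite: KohenPacetti2016, Thm. 3.6, Thm. 3.7, Rem. 3.8] [cite: CaiShuTian2014, Thm. 1.5] [cite: Jetchev2008, Thm. 1.1 (p. 812)]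
[cite: FriedbergHoffstein1995, Thm. B] [cite: JetchevSkinnerWan2017, §7.4.2 (p. 31) (a)–(d)] [cite: SilvermanATAEC1994, IV.9.4, Cor. IV.9.2 (d)]
[cite: Miller2011LMS, Def. 1.1]. presearch: n/a (port of tree theorems).
-/

set_option linter.dupNamespace false
set_option autoImplicit false

noncomputable section

open scoped Classical NumberField

open WeierstrassCurve NumberField IsDedekindDomain Literature Literature.NumberTheory.EllipticCurves
  Rat.HeightOneSpectrum CongruenceSubgroup
  Literature.NumberTheory.EllipticCurves.ModularForms
  Literature.NumberTheory.EllipticCurves.Rank1Residual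
  Literature.NumberTheory.EllipticCurves.Rank1Residual.Typed
  Literature.NumberTheory.QuadraticFields.Quadratic
  Literature.NumberTheory.Automorphic
  Summit.BirchSwinnertonDyer.Rank1Residual
  Summit.BirchSwinnertonDyer.Rank1Residual.Additive
  Summit.BirchSwinnertonDyer.Rank1Residual.X11b
  Summit.BirchSwinnertonDyer.Rank1Residual.X11b.Three
  Summit.BirchSwinnertonDyer.BirchSwinnertonDyer.Theses.RamifiedHeegnerPair
  Summit.BirchSwinnertonDyer.BirchSwinnertonDyer.Theorems

namespace Summit.BirchSwinnertonDyer.BirchSwinnertonDyer.Theorems.LeafCartanKernel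

/-- **KERNEL_leaf — ROAD(HabNs) from the leaf Cartan display, the Cartan twist supply with `2` split, (F5′) by name, print and L₀.**
See the module docstring. CONDITIONAL on every displayed input; nothing about BSD is proved.
[cite: KohenPacetti2016, Thm. 3.6, Thm. 3.7] [cite: FriedbergHoffstein1995, Thm. B] [cite: Jetchev2008, Thm. 1.1 (p. 812)] [cite: Miller2011LMS, Def. 1.1] -/
theorem leafCartanRoad_of_display_of_supply_of_lowerRankZero
    -- print
    (hGZK : rank_eq_analyticRank_of_analyticRank_le_one) (hmod : hasEntireLFunction_rat)
    (hnf : exists_isNewformOf) (hJL : nonempty_shimuraParametrizationData)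
    (hCO : PastenShimura2024_componentOrders)
    -- the Cartan twist supply WITH `2` SPLIT WHEN `2 ∤ N` (Friedberg–Hoffstein Thm. B, special case; to be filed as a Literature fact)
    (hFH : ∀ (W : WeierstrassCurve ℚ) [W.IsElliptic], W.rootNumber = -1 →
      ∀ (S C : Finset ℕ), (∀ ℓ ∈ S, ∃ _ : Fact ℓ.Prime, W.HasMultiplicativeReductionAtPrime ℓ) →
        Even S.card →
        (∀ q ∈ C, ∃ _ : Fact q.Prime, q ^ 2 ∣ W.conductorNorm ℤ ∧ ¬ q ^ 3 ∣ W.conductorNorm ℤ) →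
      ∀ B : ℕ, ∃ (K : Type) (_ : Field K) (_ : NumberField K),
        IsImaginaryQuadratic K ∧ B < (NumberField.discr K).natAbs ∧
          (∀ ℓ ∈ S ∪ C, ((Ideal.span {(ℓ : ℤ)}).primesOver (𝓞 K)).ncard = 1 ∧
            ¬ (ℓ : ℤ) ∣ NumberField.discr K) ∧
          (∀ ℓ : ℕ, ℓ.Prime → ℓ ∣ W.conductorNorm ℤ → ℓ ∉ S → ℓ ∉ C →
            ((Ideal.span {(ℓ : ℤ)}).primesOver (𝓞 K)).ncard = 2) ∧
          (¬ 2 ∣ W.conductorNorm ℤ → ((Ideal.span {(2 : ℤ)}).primesOver (𝓞 K)).ncard = 2) ∧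
          (W.quadraticTwist (NumberField.discr K : ℚ)).entireLFunction 1 ≠ 0)
    -- the leaf Cartan SAVED display (= `Nscartan.LeafCartanSavedDisplayAtThree`, derived from NUM_leaf by p767141)
    (hDisp : ∀ (V : WeierstrassCurve ℚ) [V.IsElliptic] [V.IsGloballyMinimal], ¬ V.HasCM → Addv V 3 → SubGss V 3 → Surj V 3 →
      ∀ (N : ℕ) [NeZero N] (K : Type) [Field K] [NumberField K] (S C : Finset ℕ)
      (Dt : ModularParametrizationData V N)
      (X : ShimuraCurveData (∏ q ∈ S, q) (N / ∏ q ∈ S, q))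
      (W' : WeierstrassCurve ℚ) [W'.IsElliptic] (P₀ : ShimuraParametrizationData X W'),
      V.conductorNorm ℤ = N → IsImaginaryQuadratic K → NumberField.discr K < -4 → Even S.card →
      (∀ ℓ ∈ S, ℓ.Prime ∧ ℓ ∣ N ∧ ¬ ℓ ^ 2 ∣ N ∧
        ((Ideal.span {(ℓ : ℤ)}).primesOver (𝓞 K)).ncard = 1 ∧ ¬ (ℓ : ℤ) ∣ NumberField.discr K) →
      (∀ q ∈ C, ∃ _ : Fact q.Prime, q ≠ 3 ∧ q ^ 2 ∣ N ∧ ¬ q ^ 3 ∣ N ∧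
        3 ∣ (V.baseChange ℚ_[q]).localTamagawaNumber ℤ_[q] ∧
        ((Ideal.span {(q : ℤ)}).primesOver (𝓞 K)).ncard = 1 ∧ ¬ (q : ℤ) ∣ NumberField.discr K) →
      (∀ ℓ : ℕ, ℓ.Prime → ℓ ∣ N → ℓ ∉ S → ℓ ∉ C → ((Ideal.span {(ℓ : ℤ)}).primesOver (𝓞 K)).ncard = 2) →
      ¬ (3 : ℤ) ∣ Dt.c → P₀.IsMinimalFor V →
      ∃ (P : (V.baseChange K).toAffine.Point) (degC : ℕ), 0 < degC ∧
        padicValNat 3 degC + C.card = padicValNat 3 P₀.deg ∧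
        LDerivEK V K =
          8 * (Real.pi : ℂ) ^ 2 * peterssonProduct (Gamma0 N) 2 Dt.f Dt.f /
              ((((Units.torsionOrder K : ℝ) / 2) ^ 2 * √|(NumberField.discr K : ℝ)| : ℝ) : ℂ) *
            ((P.canonicalHeight : ℂ) / (degC : ℂ)) ∧
        (¬ IsOfFinAddOrder P → ∀ (q : ℕ) [Fact q.Prime] (s : ℕ), q ∉ S → q ∉ C →
          s ≤ padicValNat 3 ((V.baseChange ℚ_[q]).localTamagawaNumber ℤ_[q]) →
          padicValNat 3 (Nat.card (AddCommGroup.primaryComponent (V.baseChange K).sha 3)) + 2 * s ≤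
            2 * padicValNat 3 (AddSubgroup.zmultiples P).index))
    -- L₀ (item 26023)
    (hL0 : Gss2LowerAtThreeRankZero)
    -- the leaf curve with its optimal datum, on the habitat HabNs (spelled inline)
    (W : WeierstrassCurve ℚ) [W.IsElliptic] [W.IsGloballyMinimal] (N : ℕ) [NeZero N]
    (Dt : ModularParametrizationData W N)
    (hCM : ¬ W.HasCM) (hadd : Addv W 3) (hsub : SubGss W 3) (hr : W.analyticRank = 1) (hN : W.conductorNorm ℤ = N)
    (hc : ¬ (3 : ℤ) ∣ Dt.c) (hsurj : Surj W 3)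
    (C : Finset ℕ)
    (hCdata : ∀ q ∈ C, ∃ _ : Fact q.Prime, q ≠ 3 ∧ q ^ 2 ∣ W.conductorNorm ℤ ∧ ¬ q ^ 3 ∣ W.conductorNorm ℤ ∧
      3 ∣ (W.baseChange ℚ_[q]).localTamagawaNumber ℤ_[q])
    (q₁ : ℕ) (hq₁3 : q₁ ≠ 3)
    (hmono : ∀ (q : ℕ) [Fact q.Prime], q ∉ C → q ≠ q₁ → ¬ 3 ∣ (W.baseChange ℚ_[q]).localTamagawaNumber ℤ_[q]) :
    MissingUpperBoundAt W 3 := by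
  subst hN
  haveI h3F : Fact (Nat.Prime 3) := ⟨Nat.prime_three⟩
  have hp : (3 : ℕ).Prime := Nat.prime_three
  have hbad3 : ¬ W.HasGoodReductionAtPrime 3 := not_good_of_addv W 3 hadd
  have h3C : (3 : ℕ) ∉ C := by
    intro h
    obtain ⟨_, h33, -⟩ := hCdata 3 h
    exact h33 rfl
  have hCsq : ∀ q ∈ C, ∃ _ : Fact q.Prime, q ^ 2 ∣ W.conductorNorm ℤ ∧ ¬ q ^ 3 ∣ W.conductorNorm ℤ := by
    intro q hq
    obtain ⟨hqF, -, h2, h3, -⟩ := hCdata q hq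
    exact ⟨hqF, h2, h3⟩
  -- (F5′) at the Cartan places: the local budget over the pair
  have hbudget : ∀ (K : Type) [Field K] [NumberField K], IsImaginaryQuadratic K →
      (∀ q ∈ C, ((Ideal.span {(q : ℤ)}).primesOver (𝓞 K)).ncard = 1 ∧ ¬ (q : ℤ) ∣ NumberField.discr K) →
      ∀ (Cd : VariableChange ℚ) (Wd : WeierstrassCurve ℚ) [Wd.IsElliptic] [Wd.IsGloballyMinimal],
        Cd • W.quadraticTwist (NumberField.discr K : ℚ) = Wd →
        ∀ (q : ℕ) [Fact q.Prime], q ∈ C →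
          padicValNat 3 ((W.baseChange ℚ_[q]).localTamagawaNumber ℤ_[q]) +
            padicValNat 3 ((Wd.baseChange ℚ_[q]).localTamagawaNumber ℤ_[q]) ≤ 1 := by
    intro K _ _ hK hCin Cd Wd _ _ hWd q hqF hq
    obtain ⟨_, hq3, h2, h3, hcq⟩ := hCdata q hq
    obtain ⟨hn, hd⟩ := hCin q hq
    exact (CartanPlaceTwistLaw.cartanPlaceTwistLawAtThree W q hq3 h2 h3 hcq K hK hn hd Cd Wd hWd).1
  -- `c_ℓ = ord_ℓ Δ_min` at a split multiplicative prime
  have hsplitval : ∀ (ℓ : ℕ) [Fact ℓ.Prime], W.HasSplitMultiplicativeReductionAtPrime ℓ →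
      (W.baseChange ℚ_[ℓ]).localTamagawaNumber ℤ_[ℓ] = padicValInt ℓ W.minimalDiscriminantInt := by
    intro ℓ hℓF hs
    exact X11b.localTamagawaNumber_eq_padicValInt_of_split W (primesEquiv.symm ⟨ℓ, hℓF.out⟩)
      (by rw [Equiv.apply_symm_apply]) hs
  -- the exempted bad place `e ∉ C` off which nothing carries: `q₁` if it is a bad prime, else `3`
  have key : ∃ (e : ℕ) (_ : Fact e.Prime), ¬ W.HasGoodReductionAtPrime e ∧ e ∉ C ∧
      ∀ (q : ℕ) [Fact q.Prime], q ∉ C → q ≠ e → ¬ 3 ∣ (W.baseChange ℚ_[q]).localTamagawaNumber ℤ_[q] := by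
    by_cases h : ∃ _ : Fact q₁.Prime, ¬ W.HasGoodReductionAtPrime q₁ ∧ q₁ ∉ C
    · obtain ⟨hq₁F, hbad₁, hq₁C⟩ := h
      exact ⟨q₁, hq₁F, hbad₁, hq₁C, fun q _ hqC hne ↦ hmono q hqC hne⟩
    · refine ⟨3, h3F, hbad3, h3C, fun q hqF hqC hq3 hdvd ↦ ?_⟩
      by_cases hqq : q = q₁
      · subst hqq
        by_cases hqC' : q ∈ C
        · exact hqC hqC'
        refine h ⟨hqF, fun hgood ↦ ?_, hqC'⟩
        rw [localTamagawaNumber_padic_eq_one_of_good_holds W q hgood] at hdvd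
        omega
      · exact hmono q hqC hqq hdvd
  obtain ⟨e, heF, hbade, heC, hnocarry⟩ := key
  have hshape : ∀ (q : ℕ) [Fact q.Prime], q ≠ e → q ∉ C → 3 ∣ (W.baseChange ℚ_[q]).localTamagawaNumber ℤ_[q] →
      W.HasSplitMultiplicativeReductionAtPrime q := fun q _ hne hqC hdvd ↦ absurd hdvd (hnocarry q hqC hne)
  have hFC : ∀ (ℓ : ℕ) [Fact ℓ.Prime], ℓ ∉ (∅ : Finset ℕ) → ℓ ≠ e → ℓ ∉ C → W.HasSplitMultiplicativeReductionAtPrime ℓ →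
      ¬ 3 ∣ padicValInt ℓ W.minimalDiscriminantInt := by
    intro ℓ _ _ hne hℓC hs hdvd
    exact hnocarry ℓ hℓC hne (by rw [hsplitval ℓ hs]; exact_mod_cast hdvd)
  have hSmult : ∀ ℓ ∈ (∅ : Finset ℕ), ∃ _ : Fact ℓ.Prime, W.HasMultiplicativeReductionAtPrime ℓ :=
    fun ℓ h ↦ absurd h (Finset.notMem_empty ℓ)
  have hSeven : Even (∅ : Finset ℕ).card := ⟨0, rfl⟩
  have hDEG : (∃ ℓ₀ ∈ (∅ : Finset ℕ), ¬ 3 ∣ padicValInt ℓ₀ W.minimalDiscriminantInt) ∨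
      (∃ ℓ₀ t : ℕ, ∃ _ : Fact ℓ₀.Prime, ∃ _ : Fact t.Prime,
        W.HasMultiplicativeReductionAtPrime ℓ₀ ∧ W.HasMultiplicativeReductionAtPrime t ∧
        ℓ₀ ∉ (∅ : Finset ℕ) ∧ t ∉ (∅ : Finset ℕ) ∧ t ≠ ℓ₀ ∧ ¬ 3 ∣ padicValInt ℓ₀ W.minimalDiscriminantInt) ∨
      (∃ R : Finset ℕ, R ⊆ (∅ : Finset ℕ) ∧ 2 * R.card = (∅ : Finset ℕ).card ∧ ∀ q ∈ R, q = 2 ∨ ¬ 3 ∣ q - 1) :=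
    Or.inr (Or.inr ⟨∅, Finset.Subset.refl _, by simp, fun q h ↦ absurd h (Finset.notMem_empty q)⟩)
  -- the field: `C` inert-unramified, every other bad prime split, `2` split if `2 ∤ N`, `|d_K| > 4`, `L(W^{(d_K)},1) ≠ 0`
  have hw : W.rootNumber = -1 := by
    rw [WeierstrassCurve.rootNumber_eq_neg_one_pow_analyticRank_of_exists_isNewformOf hnf W, hr]
    norm_num
  obtain ⟨K, _, _, hK, hB, hinSC, hsplitN, h2, hLt⟩ := hFH W hw ∅ C hSmult hSeven hCsq 4
  have hinertC : ∀ q ∈ C, ((Ideal.span {(q : ℤ)}).primesOver (𝓞 K)).ncard = 1 ∧ ¬ (q : ℤ) ∣ NumberField.discr K :=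
    fun q hq ↦ hinSC q (Finset.mem_union_right ∅ hq)
  have hinert : ∀ ℓ ∈ (∅ : Finset ℕ), ((Ideal.span {(ℓ : ℤ)}).primesOver (𝓞 K)).ncard = 1 ∧
      ¬ (ℓ : ℤ) ∣ NumberField.discr K := fun ℓ h ↦ absurd h (Finset.notMem_empty ℓ)
  -- `d_K` is odd: `2` is a Cartan place (inert-unramified), a bad prime off `C` (split), or split by the clause
  have hodd : Odd (NumberField.discr K) := by
    refine LeafShimuraInert.odd_discr_of_two_inert_or_split hK.1 ?_
    by_cases h2C : 2 ∈ C
    · left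
      obtain ⟨hn, hd⟩ := hinertC 2 h2C
      exact ⟨by exact_mod_cast hn, by exact_mod_cast hd⟩
    · right
      by_cases h2N : 2 ∣ W.conductorNorm ℤ
      · exact_mod_cast hsplitN 2 Nat.prime_two h2N (Finset.notMem_empty 2) h2C
      · exact h2 h2N
  -- `d_K < -4`
  have hD : NumberField.discr K < -4 := by
    haveI : IsTotallyComplex K := hK.2
    have hneg : NumberField.discr K < 0 := discr_neg_of_finrank_eq_two K hK.1
    have hB' : 4 < (NumberField.discr K).natAbs := hB
    omega
  -- `3` splits (bad, off `C`), so the minimal twist is a rank-zero LEAF curve: L₀ pays its lower half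
  have h3N : 3 ∣ W.conductorNorm ℤ := (W.dvd_conductorNorm_iff_not_hasGoodReductionAtPrime 3).mpr hbad3
  have hH3 : SatisfiesHeegnerHypothesis 3 K := fun q hq hq3 ↦ by
    have : q = 3 := (Nat.prime_dvd_prime_iff_eq hq hp).mp hq3
    subst this
    exact hsplitN 3 hp h3N (Finset.notMem_empty 3) h3C
  have hD0 : (NumberField.discr K : ℚ) ≠ 0 := by exact_mod_cast NumberField.discr_ne_zero K
  haveI hEt : (W.quadraticTwist (NumberField.discr K : ℚ)).IsElliptic := W.isElliptic_quadraticTwist hD0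
  have hPL : ∀ (Wd : WeierstrassCurve ℚ) [Wd.IsElliptic] [Wd.IsGloballyMinimal] (Cd : VariableChange ℚ),
      Cd • W.quadraticTwist (NumberField.discr K : ℚ) = Wd → MissingLowerBoundAt Wd 3 := by
    intro Wd _ _ Cd hWd
    obtain ⟨hCMd, haddd, hsubd, -⟩ := LeafShimuraInert.leaf_twist_of_split_three W hCM hadd hsub K hK hH3 hodd Wd Cd hWd
    have hrd : Wd.analyticRank = 0 := by
      rw [← hWd, analyticRank_smul]
      exact Rank1Residual.analyticRank_eq_zero_of_entireLFunction_one_ne_zero hLt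
    exact hL0 Wd hCMd haddd hsubd hrd
  -- the display at `(K, ∅, C)`
  have hCin : ∀ q ∈ C, ∃ _ : Fact q.Prime, q ≠ 3 ∧ q ^ 2 ∣ W.conductorNorm ℤ ∧ ¬ q ^ 3 ∣ W.conductorNorm ℤ ∧
      3 ∣ (W.baseChange ℚ_[q]).localTamagawaNumber ℤ_[q] ∧
      ((Ideal.span {(q : ℤ)}).primesOver (𝓞 K)).ncard = 1 ∧ ¬ (q : ℤ) ∣ NumberField.discr K := by
    intro q hq
    obtain ⟨hqF, hq3, h2', h3', hcq⟩ := hCdata q hq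
    obtain ⟨hn, hd⟩ := hinertC q hq
    exact ⟨hqF, hq3, h2', h3', hcq, hn, hd⟩
  have hSin : ∀ ℓ ∈ (∅ : Finset ℕ), ℓ.Prime ∧ ℓ ∣ W.conductorNorm ℤ ∧ ¬ ℓ ^ 2 ∣ W.conductorNorm ℤ ∧
      ((Ideal.span {(ℓ : ℤ)}).primesOver (𝓞 K)).ncard = 1 ∧ ¬ (ℓ : ℤ) ∣ NumberField.discr K :=
    fun ℓ h ↦ absurd h (Finset.notMem_empty ℓ)
  have hHKat : ∀ (X : ShimuraCurveData (∏ q ∈ (∅ : Finset ℕ), q) (W.conductorNorm ℤ / ∏ q ∈ (∅ : Finset ℕ), q))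
      (W' : WeierstrassCurve ℚ) [W'.IsElliptic] (P₀ : ShimuraParametrizationData X W'), P₀.IsMinimalFor W →
      ∃ (P : (W.baseChange K).toAffine.Point) (degS : ℕ), 0 < degS ∧
        padicValNat 3 degS + C.card = padicValNat 3 P₀.deg ∧
        LDerivEK W K =
          8 * (Real.pi : ℂ) ^ 2 * peterssonProduct (Gamma0 (W.conductorNorm ℤ)) 2 Dt.f Dt.f /
              ((((Units.torsionOrder K : ℝ) / 2) ^ 2 * √|(NumberField.discr K : ℝ)| : ℝ) : ℂ) *
            ((P.canonicalHeight : ℂ) / (degS : ℂ)) ∧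
        (¬ IsOfFinAddOrder P → ∀ (q : ℕ) [Fact q.Prime] (s : ℕ), q ∉ (∅ : Finset ℕ) → q ∉ C →
          s ≤ padicValNat 3 ((W.baseChange ℚ_[q]).localTamagawaNumber ℤ_[q]) →
          padicValNat 3 (Nat.card (AddCommGroup.primaryComponent (W.baseChange K).sha 3)) + 2 * s ≤
            2 * padicValNat 3 (AddSubgroup.zmultiples P).index) :=
    fun X W' _ P₀ hP₀ ↦ hDisp W hCM hadd hsub hsurj (W.conductorNorm ℤ) K ∅ C Dt X W' P₀ rfl hK hD hSeven hSin hCin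
      hsplitN hc hP₀
  -- part 1: the leaf budget-set core at `S = ∅`
  haveI := heF
  exact leafRankOneUpper_three_of_shimuraInertDatum_at_saving_of_budgetSet hGZK hmod hnf hJL hCO W hadd hsub hr rfl Dt hc
    ∅ hSeven hSmult e hbade (Finset.notMem_empty e) C heC hCdata hbudget hFC hshape hDEG K hK hodd hinert hinertC
    hsplitN hLt hHKat hPL

end Summit.BirchSwinnertonDyer.BirchSwinnertonDyer.Theorems.LeafCartanKernel

end
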